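import Literature.Computability.Complexity.TVCheckerParse
import Literature.Computability.Complexity.OnesZeroPadding
import HarnessLib

/-!
# The downward checker of Trevisan–Vadhan's language: completeness, soundness, and Murray–Williams'
# `NQP ⊄ ACC⁰` from `PSPACE`-hardness and downward self-reducibility of `LTV` alone

Literature / complexity — the top of the checker tower (`TVCheckerBricks` … `TVCheckerParse`, analysis
`DownwardChainChecker` / `TVDownwardCheckerAnalysis`): the string function `TVChk.tvCheckFn acc`
(Santhanam 2009, Lemma 12 for Trevisan–Vadhan's `PSPACE`-complete language `QBFUniv.LTV`, in the
description form `DownwardCheckerFn` of `OnesZeroPadding.lean`, at the language's OWN small field) is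

* polynomial time uniformly in the access brick (`tvCheckFn_mem_FP`);
* **perfectly complete** behind every access brick answering `LTV` on the queries shorter than the
  input (`TVChk.tvCheckFn_complete`: the level oracle it presents is truthful on the deeper levels,
  `QBFUniv.pointOracle_eq_eval`, so every run returns the true bit, `QBFUniv.tv_checksV_of_honest`);
* **`1/3`-sound** whatever the access brick (`TVChk.tvCheckFn_sound`: the accepting coin strings are
  counted through the bijection coins ↔ sixty-four challenge sequences, `TVChk.coinsToRuns_bijective`,
  and `QBFUniv.tv_prob_forall_checksV_le`);

hence **`TVChk.tvDownwardChecker : DownwardCheckerFn LTV`**, and with `OnesZeroPadding.lean`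
(Murray–Williams' SIAM Thm. 2.7 padding) the language of MW's Thm. 2.2 and the headline follow from the
two remaining properties of `LTV` — `PSPACE`-hardness and a downward self-reduction MACHINE of
Impagliazzo–Wigderson's Def. 6 form (both about `TVFunction.lean`'s `LTV`; its functional downward
self-reducibility is `QBFUniv.Fni_eq_of_queries`):
**`MurrayWilliams2018_NQP_not_subset_ACC0_of_LTV`**, `MurrayWilliams2018_thm_2_2_language_of_LTV`,
`MurrayWilliams2018_lemma_4_1_ae_of_LTV_of_umansGenerator`.

Everything is proved; no named fact is introduced (D-0026).

## References

* R. Santhanam, *Circuit lower bounds for Merlin–Arthur classes*, SIAM J. Comput. 39 (2009), Lemma 12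
  [Santhanam2009].
* L. Trevisan, S. Vadhan, *Pseudorandomness and average-case complexity via uniform reductions*,
  Comput. Complexity 16 (2007), Thm. 4.3, Thm. 5.4 [TrevisanVadhan2007].
* C. D. Murray, R. R. Williams, SIAM J. Comput. 49(5) (2020), Thm. 2.7 (= STOC 2018 Thm. 2.2), Thm. 3.1,
  §1.1 [MurrayWilliams2018].
* C. Lund, L. Fortnow, H. Karloff, N. Nisan, J. ACM 39 (1992), §3 [LundEtAl1992].
* S. Arora, B. Barak, CUP 2009, §8.3, §7.4.1 [AroraBarakCC2009].
-/

noncomputable section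

namespace Literature.Computability.Complexity

open _root_.Computability Polynomial Finset Brick Plumb GF2Str HardLangM TVBrick QBFUniv SelfCorrect
  Literature.InformationTheory.Coding

namespace TVChk

/-! ### The coins read are a prefix -/

/-- A challenge inside the prefix is read off the prefix. [folklore] -/
theorem coinVal_take (n : ℕ) (r : List Bool) {L₀ j : ℕ} (hj : (j + 1) * blk n ≤ L₀) : coinVal n (r.take L₀) j = coinVal n r j := by
  rw [coinVal, coinVal]
  congr 1
  funext l
  have hb : blk n = Mof n + 1 := rfl
  have hl : j * blk n + l.val < L₀ := by have := l.isLt; rw [Nat.succ_mul] at hj; omega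
  rw [List.getD_eq_getElem?_getD, List.getD_eq_getElem?_getD, List.getElem?_take_of_lt hl]

/-- **The verdicts of the sixty-four runs read the coin prefix of length `64 m' (blk n)`.** [folklore] -/
theorem checksOf_take {n : ℕ} (hn : 0 < n) (acc : List Bool → List Bool) (e w r : List Bool) (i m' : ℕ) {t : ℕ} (ht : t < 64) :
    checksOf n hn acc e w (r.take (64 * m' * blk n)) i m' t = checksOf n hn acc e w r i m' t := by
  have hfun : (fun s : Fin m' => runCoins n (r.take (64 * m' * blk n)) t m' s.val) = fun s => runCoins n r t m' s.val := by
    funext s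
    have h1 : (t + 1) * m' ≤ 64 * m' := Nat.mul_le_mul_right _ ht
    have h2 : t * m' + s.val + 1 ≤ 64 * m' := by have := s.isLt; nlinarith [h1]
    exact coinVal_take n r (Nat.mul_le_mul_right _ h2)
  rw [checksOf, checksOf, hfun]

/-! ### Coins and challenge sequences -/

/-- **The sixty-four challenge sequences read off a coin function.** [folklore] -/
def coinsToRuns (n m' : ℕ) (f : Fin (64 * m' * blk n) → Bool) : Fin 64 → Fin m' → K n :=
  fun t s => coinVal n (List.ofFn f) (t.val * m' + s.val)

/-- **Coins ↔ challenge sequences is a bijection** (`decF` is, block by block). [folklore] -/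
theorem coinsToRuns_bijective (n m' : ℕ) : Function.Bijective (coinsToRuns n m') := by
  classical
  refine (Fintype.bijective_iff_injective_and_card _).2 ⟨fun f g hfg => ?_, ?_⟩
  · funext p
    rcases Nat.eq_zero_or_pos m' with rfl | hm
    · exact absurd p.isLt (by simp)
    set q := p.val / blk n with hq
    set l := p.val % blk n with hl
    have hqlt : q < 64 * m' := by
      rw [hq, Nat.div_lt_iff_lt_mul (blk_pos n)]; exact p.isLt
    have ht : q / m' < 64 := (Nat.div_lt_iff_lt_mul hm).2 (by omega)
    have hs : q % m' < m' := Nat.mod_lt _ hm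
    have key := congrFun (congrFun hfg ⟨q / m', ht⟩) ⟨q % m', hs⟩
    simp only [coinsToRuns] at key
    have hqq : q / m' * m' + q % m' = q := Nat.div_add_mod' q m'
    rw [hqq] at key
    have key' := congrFun (congrArg (encF (Mof n)) key) ⟨l, Nat.mod_lt _ (blk_pos n)⟩
    rw [coinVal, coinVal, encF_decF, encF_decF] at key'
    simp only at key'
    have hp : q * blk n + l = p.val := by rw [hq, hl]; exact Nat.div_add_mod' p.val (blk n)
    rw [hp, List.getD_eq_getElem?_getD, List.getD_eq_getElem?_getD, List.getElem?_ofFn, List.getElem?_ofFn] at key'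
    simpa using key'
  · rw [Fintype.card_fun, Fintype.card_fin, Fintype.card_bool, Fintype.card_fun, Fintype.card_fin, Fintype.card_fun, Fintype.card_fin,
      card_K, ← pow_mul, ← pow_mul]
    congr 1; ring

/-- Counting through a bijection. [folklore] -/
theorem card_filter_comp_of_bijective {α β : Type*} [Fintype α] [Fintype β] [DecidableEq β] (Φ : α → β)
    (hΦ : Function.Bijective Φ) (P : β → Prop) [DecidablePred P] :
    (univ.filter fun a => P (Φ a)).card = (univ.filter P).card := by
  rw [← Finset.card_image_of_injective (univ.filter fun a => P (Φ a)) hΦ.1]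
  congr 1
  ext b
  simp only [mem_image, mem_filter, mem_univ, true_and]
  constructor
  · rintro ⟨a, ha, rfl⟩; exact ha
  · intro hb; obtain ⟨a, rfl⟩ := hΦ.2 b; exact ⟨a, hb, rfl⟩

/-- Monotonicity of `uniformProb` on the strings of the given length. [folklore] -/
theorem uniformProb_mono_of_len {m : ℕ} {E E' : Set (List Bool)} (h : ∀ r : List Bool, r.length = m → r ∈ E → r ∈ E') :
    uniformProb m E ≤ uniformProb m E' := by
  classical
  rw [uniformProb_eq_card_fun, uniformProb_eq_card_fun]
  refine div_le_div_of_nonneg_right ?_ (by positivity)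
  exact_mod_cast Finset.card_le_card fun f hf => by
    simp only [mem_filter, mem_univ, true_and] at hf ⊢
    exact h _ (List.length_ofFn) hf

/-! ### The level oracle presented behind an access brick right on the shorter queries -/

/-- Behind an access brick answering `LTV` on the queries shorter than `w` (canonical, size `n > 0`,
stage `i = iOf |w|`), the level oracle is truthful on the levels `i' ∈ (i, mlen n]`. [cite: TrevisanVadhan2007, Thm. 4.3 (proof, (b): the deeper levels are shorter)] -/
theorem levelO_honest (acc : List Bool → List Bool) (e w : List Bool)
    (hacc : ∀ q : List Bool, q.length < w.length → (acc (boolPair q e) = [true] ↔ q ∈ LTV))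
    (hc : ptLen (nOf w.length) + blk (nOf w.length) ≤ w.length - pre (nOf w.length)) :
    ∀ i', iOf w.length < i' → i' ≤ mlen (nOf w.length) → ∀ y,
      levelO acc e (nOf w.length) i' y = MvPolynomial.eval y (fam (K (nOf w.length)) (nOf w.length) i') := by
  intro i' hi hi' y
  rw [levelO, pointOracle_eq_eval _ hi' (fun z hz => ?_)]
  have hzl : z.length < w.length := by
    rcases h_nOf_iOf w hc with heq | ⟨h0, hlt⟩
    · calc z.length = h (nOf w.length) i' := hz
        _ < h (nOf w.length) (iOf w.length) := h_lt_h hi hi'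
        _ = w.length := heq
    · rw [hz]; rw [h0] at hi; exact lt_of_le_of_lt (by rw [h, h]; omega) hlt
  have hiff := hacc z hzl
  rw [accOracle]
  cases hF : FB z
  · exact decide_eq_false fun ha => absurd (show FB z = true from hiff.1 ha) (by rw [hF]; exact Bool.false_ne_true)
  · exact decide_eq_true (hiff.2 hF)

/-! ### Completeness and soundness of the checker -/

/-- The coin budget: `64 m' (blk n) ≤ 64 (|w| + 1)³` for `m' ≤ mlen n`, `ptLen n + blk n ≤ |w|`. [folklore] -/
theorem coins_le {n : ℕ} {w : List Bool} (hw : ptLen n + blk n ≤ w.length) {m' : ℕ} (hm : m' ≤ mlen n) :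
    64 * m' * blk n ≤ (64 * (X + 1) ^ 3 : Polynomial ℕ).eval w.length := by
  simp only [eval_mul, eval_pow, eval_add, eval_X, eval_one, eval_ofNat]
  have h1 : n ≤ w.length := (le_N n).trans ((N_le_ptLen n).trans (by omega))
  have h2 : N n ≤ w.length := (N_le_ptLen n).trans (by omega)
  have h3 : blk n ≤ w.length := by omega
  have h4 : m' ≤ w.length * (w.length + 1) := by
    rw [mlen, length_uops] at hm; exact hm.trans (Nat.mul_le_mul h1 (by omega))
  have h5 : m' * blk n ≤ w.length * (w.length + 1) * w.length := Nat.mul_le_mul h4 h3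
  nlinarith [h5]

/-- **Perfect completeness of the checker.** [cite: Santhanam2009, Lemma 12 (2)] [cite: LundEtAl1992, §3 (completeness)] -/
theorem tvCheckFn_complete (acc : List Bool → List Bool) (e w : List Bool) (hw : w ∈ LTV)
    (hacc : ∀ q : List Bool, q.length < w.length → (acc (boolPair q e) = [true] ↔ q ∈ LTV))
    (r : List Bool) (hr : (64 * (X + 1) ^ 3 : Polynomial ℕ).eval w.length ≤ r.length) :
    tvCheckFn acc (boolPair (boolPair w r) e) = [true] := by
  have hFB : FB w = true := hw
  rcases tvCheckFn_cases acc w r e with ⟨hnc, _⟩ | ⟨_, _, h⟩ | ⟨hc, hpos, h⟩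
  · rcases FB_cases w with ⟨_, hF⟩ | ⟨hc, -⟩
    · rw [hF] at hFB; exact absurd hFB (by simp)
    · exact absurd hc hnc
  · exact h
  · rw [h]
    set n := nOf w.length with hn
    set i := iOf w.length with hi
    have hile : i ≤ mlen n := iOf_le _
    have hFni : FB w = Fni n i w := by
      rcases FB_cases w with ⟨hnc, -⟩ | ⟨-, hF, -⟩
      · exact absurd hc hnc
      · exact hF
    have hwl : ptLen n + blk n ≤ w.length := by have := (nOf_spec w.length).1; omega
    rw [← Nat.add_sub_assoc hile, chkCoreF_apply hpos acc (by omega) r e (Nat.add_sub_cancel' hile)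
      ((coins_le hwl (Nat.sub_le _ _)).trans hr)]
    simp only [List.cons.injEq, and_true, allBelow_eq_true_iff]
    intro t _
    rw [checksOf, tv_checksV_of_honest hpos _ _ (i := i) (j := mlen n - i) (by omega) (levelO_honest acc e w hacc hc)]
    rw [hFni] at hFB
    exact hFB

/-- **Soundness of the checker**: a word outside `LTV` is accepted with probability `≤ 1/3` over any
number `L ≥ 64 (|w|+1)³` of coins, whatever the access brick and carrier. [cite: Santhanam2009, Lemma 12 (3)] [cite: AroraBarakCC2009, Thm. 8.21 (Claim)] -/
theorem tvCheckFn_sound (acc : List Bool → List Bool) (e w : List Bool) (hw : w ∉ LTV)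
    {L : ℕ} (hL : (64 * (X + 1) ^ 3 : Polynomial ℕ).eval w.length ≤ L) :
    uniformProb L {r | tvCheckFn acc (boolPair (boolPair w r) e) = [true]} ≤ 1 / 3 := by
  have hFB : FB w = false := by
    cases hF : FB w
    · rfl
    · exact absurd hF hw
  rcases tvCheckFn_cases acc w [] e with ⟨hnc, -⟩ | ⟨hc, h0, -⟩ | ⟨hc, hpos, -⟩
  · -- off the canonical lengths nothing accepts
    have hE : {r | tvCheckFn acc (boolPair (boolPair w r) e) = [true]} = ∅ := by
      refine Set.eq_empty_iff_forall_notMem.2 fun r hr => ?_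
      rcases tvCheckFn_cases acc w r e with ⟨-, h⟩ | ⟨hc, -⟩ | ⟨hc, -⟩
      · rw [Set.mem_setOf_eq, h] at hr; exact absurd hr (by simp)
      · exact hnc hc
      · exact hnc hc
    rw [hE, uniformProb_empty]; norm_num
  · -- size `0`: impossible, the function is `1` there
    rcases FB_cases w with ⟨hnc, -⟩ | ⟨-, hF, -⟩
    · exact absurd hc hnc
    · rw [hF, h0, Fni_size_zero] at hFB; exact absurd hFB (by simp)
  · set n := nOf w.length with hn
    set i := iOf w.length with hi
    have hile : i ≤ mlen n := iOf_le _
    have hwl : ptLen n + blk n ≤ w.length := by have := (nOf_spec w.length).1; omega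
    set m' := mlen n - i with hm'
    have him : i + m' = mlen n := Nat.add_sub_cancel' hile
    have hL₀ : 64 * m' * blk n ≤ L := (coins_le hwl (Nat.sub_le _ _)).trans hL
    have hbad : goodBit n (jOf n w) (MvPolynomial.eval (xOf n w) (fam (K n) n i)) = false := by
      rcases FB_cases w with ⟨hnc, -⟩ | ⟨-, hF, -⟩
      · exact absurd hc hnc
      · rw [hF] at hFB; exact hFB
    -- the event on the strings of length `L` is the verifier's event, which reads a prefix
    set E' : Set (List Bool) := {r | allBelow 64 (fun t => checksOf n hpos acc e w r i m' t) = true} with hE'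
    have hstep1 : uniformProb L {r | tvCheckFn acc (boolPair (boolPair w r) e) = [true]} ≤ uniformProb L E' := by
      refine uniformProb_mono_of_len fun r hrL hr => ?_
      rcases tvCheckFn_cases acc w r e with ⟨hnc, -⟩ | ⟨-, h0, -⟩ | ⟨-, -, h⟩
      · exact absurd hc hnc
      · omega
      · rw [Set.mem_setOf_eq, h, ← Nat.add_sub_assoc hile, chkCoreF_apply hpos acc (by omega) r e him (by rw [hrL]; exact hL₀)] at hr
        rw [hE']
        simpa using hr
    have hstep2 : E' = {r | r.take (64 * m' * blk n) ∈ E'} := by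
      ext r
      simp only [hE', Set.mem_setOf_eq]
      rw [allBelow_congr fun t ht => checksOf_take hpos acc e w r i m' ht]
    have hstep3 : uniformProb (64 * m' * blk n) E' ≤ 1 / 3 := by
      rw [uniformProb_eq_card_fun, Finset.filter_congr_decidable]
      have hcard : (univ.filter fun f : Fin (64 * m' * blk n) → Bool => List.ofFn f ∈ E').card =
          (univ.filter fun R : Fin 64 → Fin m' → K n =>
            ∀ t, (tvChain n hpos).checksV (node n) (stageDeg n) (levelO acc e n) (goodBit n (jOf n w)) m' i (xOf n w) (R t) = true).card := by
        rw [← card_filter_comp_of_bijective _ (coinsToRuns_bijective n m')]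
        congr 1
        ext f
        simp only [mem_filter, mem_univ, true_and, hE', Set.mem_setOf_eq, allBelow_eq_true_iff, checksOf, runCoins]
        constructor
        · intro h t; exact h t.val t.isLt
        · intro h t ht; exact h ⟨t, ht⟩
      have hden : ((2 : ℝ) ^ (64 * m' * blk n)) = ((Fintype.card (K n) : ℝ) ^ m') ^ 64 := by
        rw [card_K, Nat.cast_pow, ← pow_mul, ← pow_mul]
        push_cast
        rw [show 64 * m' * blk n = blk n * (m' * 64) by ring]
      rw [hcard, hden]
      exact tv_prob_forall_checksV_le hpos (levelO acc e n) (goodBit n (jOf n w)) (i := i) (j := m') (by omega) (xOf n w) hbad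
    calc uniformProb L {r | tvCheckFn acc (boolPair (boolPair w r) e) = [true]}
        ≤ uniformProb L E' := hstep1
      _ = uniformProb L {r | r.take (64 * m' * blk n) ∈ E'} := by rw [← hstep2]
      _ = uniformProb (64 * m' * blk n) E' := uniformProb_take_of_le hL₀ E'
      _ ≤ 1 / 3 := hstep3

/-- **THE DOWNWARD CHECKER OF TREVISAN–VADHAN'S LANGUAGE** in description form (Santhanam's Lemma 12 for
`LTV`, at its own field): polynomial time uniformly in the access brick, perfectly complete behind access
bricks right on the shorter queries, `1/3`-sound. [cite: Santhanam2009, Lemma 12] [cite: TrevisanVadhan2007, Thm. 5.4] -/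
def tvDownwardChecker : DownwardCheckerFn LTV where
  chk := tvCheckFn
  coins := 64 * (X + 1) ^ 3
  mem_FP hacc := tvCheckFn_mem_FP hacc
  complete acc e x hx hacc r hr := tvCheckFn_complete acc e x hx (fun q hq => hacc q hq.le) r hr
  sound acc e x hx _ hL := tvCheckFn_sound acc e x hx hL

end TVChk

/-! ### Murray–Williams from `LTV`: hardness and the downward self-reduction machine remain -/

open QBFUniv in
/-- **Murray–Williams' Thm. 2.2 language from Trevisan–Vadhan's `LTV`**, given its `PSPACE`-hardness and
a downward self-reduction machine of Impagliazzo–Wigderson's Def. 6 form (the functional identity is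
`QBFUniv.Fni_eq_of_queries`). [cite: MurrayWilliams2018, Thm. 2.2 (SIAM Thm. 2.7)] [cite: TrevisanVadhan2007, Thm. 4.3, Thm. 5.4] -/
theorem MurrayWilliams2018_thm_2_2_language_of_LTV (hhard : IsHard PSPACE LTV)
    (A₀ : OracleAlg (List Bool)) (hA₀ : A₀.IsPolyTime (encodingList Bool)) (bA : Polynomial ℕ)
    (hdsr : ∀ (x : List Bool) (O : Oracle), (∀ y : List Bool, y.length < x.length → O y = Oracle.ofLanguage LTV y) →
      A₀.run O (bA.eval x.length) x = some (Oracle.ofLanguage LTV x)) :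
    ∃ L : Language Bool, IsHard PSPACE L ∧ (∀ x : List Bool, true :: x ∈ L ↔ x ∈ L) ∧
      (∀ n : ℕ, List.replicate n true ∉ L) ∧ Nonempty (AlmostAE.DSR L) ∧ Nonempty (AlmostAE.SameLengthChecker L) :=
  MurrayWilliams2018_thm_2_2_language_of_downwardFn LTV hhard A₀ hA₀ bA hdsr TVChk.tvDownwardChecker

open QBFUniv in
/-- **`NQP ⊄ ACC⁰` from Trevisan–Vadhan's `LTV`**: its `PSPACE`-hardness and a downward self-reduction
machine — nothing else (the same-length checker is this tower; Thm. 3.1 and §4–§5 of Murray–Williams are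
the tree's). [cite: MurrayWilliams2018, §1.1, Thm. 1.3, Thm. 2.2, Thm. 3.1] [cite: Santhanam2009, Lemma 12] [cite: TrevisanVadhan2007, Thm. 5.4] -/
theorem MurrayWilliams2018_NQP_not_subset_ACC0_of_LTV (hhard : IsHard PSPACE LTV)
    (A₀ : OracleAlg (List Bool)) (hA₀ : A₀.IsPolyTime (encodingList Bool)) (bA : Polynomial ℕ)
    (hdsr : ∀ (x : List Bool) (O : Oracle), (∀ y : List Bool, y.length < x.length → O y = Oracle.ofLanguage LTV y) →
      A₀.run O (bA.eval x.length) x = some (Oracle.ofLanguage LTV x)) :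
    MurrayWilliams2018_NQP_not_subset_ACC0 :=
  MurrayWilliams2018_NQP_not_subset_ACC0_of_downwardFn LTV hhard A₀ hA₀ bA hdsr TVChk.tvDownwardChecker

open QBFUniv in
/-- **Lemma 4.1 (a.e. form) from `LTV`**: hardness, the downward self-reduction machine and a generator
of Umans' type (MW Thm. 2.1) remain. [cite: MurrayWilliams2018, Lemma 4.1, Thm. 2.1, Thm. 2.2, Thm. 3.1] -/
theorem MurrayWilliams2018_lemma_4_1_ae_of_LTV_of_umansGenerator (hhard : IsHard PSPACE LTV)
    (A₀ : OracleAlg (List Bool)) (hA₀ : A₀.IsPolyTime (encodingList Bool)) (bA : Polynomial ℕ)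
    (hdsr : ∀ (x : List Bool) (O : Oracle), (∀ y : List Bool, y.length < x.length → O y = Oracle.ofLanguage LTV y) →
      A₀.run O (bA.eval x.length) x = some (Oracle.ofLanguage LTV x))
    (G : UmansGenerator) : MurrayWilliams2018_lemma_4_1_ae :=
  MurrayWilliams2018_lemma_4_1_ae_of_downwardFn_of_umansGenerator LTV hhard A₀ hA₀ bA hdsr TVChk.tvDownwardChecker G

end Literature.Computability.Complexity

end
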